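import Mathlib
import Summits.NavierStokesRegularity.NavierStokesRegularity.Theorems.WakeRatchetTailRatchetScalarFrontNoSlow
import Summits.NavierStokesRegularity.NavierStokesRegularity.Theorems.WakeRatchetTailRatchetDyadicRung
import HarnessLib

/-!
# `WakeRatchet.TailRatchet` (stmt-NavierStokesRegularity-21808), DSS stratum of the dyadic member:
# a DELAY FLOOR — no slow admissible single-profile DSS waves, `e^T − 1 ≥ 1/((6Λ+2Λ⁻¹)(C+ΛC²+C²/Λ))`

Support file for the crux `TailRatchet` (route `WakeRatchet`; MODEL lattice ODEs of Tao 2016 §1.2, §4 —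
nothing here concerns the Navier–Stokes equations; no item is closed).  The registered plan-only rung
`stub_rung_dss` of `Cruxes/TailRatchet/Lines/birth.lean` (uniform-fraction tail ratchet along every uniformly
bounded admissible inviscid SHELL-SELF-SIMILAR eternal solution) is, on the dyadic member, exactly
`¬ DyadicScalarFronts` (`WakeRatchetDyadicRung.dyadicRung_iff_not_DyadicScalarFronts`) and is believed FALSE.
This file records the TRUE quantitative statement on the same stratum that the a-priori theory of scalar
fronts delivers (`WakeRatchetScalarFrontNoSlow.no_slow_front` through the inverse dictionary
`WakeRatchetDyadicWaveStrict`):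

* `delay_floor_of_dssWave` — every non-trivial admissible single-profile DSS wave `Φ` of `dyadicTable` with
  profile bound `‖Φ 0 x‖ ≤ C` has delay `T` with `(C + ΛC² + C²/Λ)·(e^T − 1) ≥ 1/(6Λ + 2Λ⁻¹)`;
* `delay_floor_of_shellSelfSimilar` — the same for every non-zero admissible inviscid eternal solution `W` of
  the dyadic member with `W_{n+1}(σ) = W_n(σ − T)`, `T > 0`, and `‖W_n(σ)‖ ≤ C`: the hypothesis class of
  `stub_rung_dss` on `dyadicTable` carries NO SLOW members — the lag per shell is bounded below by the spread
  and the type-I constant.  (The rung itself would say the class is empty below a threshold.)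

HONEST FRAMING: elementary consequences of tree theorems about a MODEL lattice ODE; the rung / crux are neither
proved nor refuted here; nothing about Navier–Stokes.
-/

noncomputable section

set_option linter.dupNamespace false

namespace Summit.NavierStokesRegularity.NavierStokesRegularity.Theorems

namespace WakeRatchetDSSDelayFloor

open Filter Topology Set MeasureTheory
open Literature.Analysis.FluidPDE Literature.Analysis.FluidPDE.TaoCascade
open WakeRatchetDyadicWaveStrict WakeRatchetDyadicRung WakeRatchetScalarFrontNoSlow

variable {ε₀ T : ℝ}

/-- **Delay floor for admissible single-profile DSS waves of the dyadic member.**  If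
`IsDSSWave ε₀ dyadicTable 1 T Φ`, `Φ 0 ≢ 0` and `‖Φ 0 x‖ ≤ C` for all `x`, then
`1/(6Λ + 2Λ⁻¹) ≤ (C + ΛC² + C²/Λ)·(e^T − 1)` (`Λ = bigLam ε₀`).
[cite: Tao2016AveragedNS, §1.2 (dyadic model), §4 Lemma 4.1 (4.8), §6.4; cell theorem] -/
theorem delay_floor_of_dssWave (hε : 0 < ε₀) {Φ : Fin 1 → ℝ → Em 4}
    (hW : IsDSSWave ε₀ dyadicTable (1 : Equiv.Perm (Fin 1)) T Φ) (hne : ∃ x, Φ 0 x ≠ 0)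
    {C : ℝ} (hC : ∀ x : ℝ, ‖Φ 0 x‖ ≤ C) :
    1 / (6 * bigLam ε₀ + 2 / bigLam ε₀)
      ≤ (C + bigLam ε₀ * C ^ 2 + C ^ 2 / bigLam ε₀) * (Real.exp T - 1) := by
  obtain ⟨x, hx⟩ := hne
  have hs : 1 < Real.exp T := by
    have := hW.delay_pos; rw [← Real.exp_zero]; exact Real.exp_lt_exp.2 this
  -- the type-I bound of the scalar front `a(t) = e^{x}Φ 0 x 0`, `x = -log(-t)`: `|t|·|a(t)| = ‖Φ 0 x‖`
  have hM : ∀ t : ℝ, t < 0 →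
      |t| * |Real.exp (-Real.log (-t)) * Φ 0 (-Real.log (-t)) 0| ≤ C := by
    intro t ht
    have e1 : Real.exp (-Real.log (-t)) = (-t)⁻¹ := by
      rw [Real.exp_neg, Real.exp_log (by linarith)]
    rw [e1, abs_mul, abs_of_pos (inv_pos.2 (by linarith : (0:ℝ) < -t)), abs_of_neg ht,
      ← mul_assoc, mul_inv_cancel₀ (by linarith : (-t) ≠ 0), one_mul,
      ← norm_eq_abs hε hW]
    exact hC _
  exact no_slow_front hε hs (fun t ht => front_hasDerivAt hε hW t ht) (front_integrableOn hε hW)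
    (front_bdd hε hW) (front_ne_zero hε hW hx) hM

/-- **Delay floor on the `stub_rung_dss` stratum of the dyadic member.**  Every non-zero admissible inviscid
eternal solution `W` of `dyadicTable` that is shell-self-similar with lag `T > 0`
(`W_{n+1}(σ) = W_n(σ − T)`) and uniformly bounded by `C` satisfies
`1/(6Λ + 2Λ⁻¹) ≤ (C + ΛC² + C²/Λ)·(e^T − 1)`.
[cite: Tao2016AveragedNS, §1.2, §4 Lemma 4.1 (4.8), §6.4; cell theorem] -/
theorem delay_floor_of_shellSelfSimilar (hε : 0 < ε₀) {W : ℤ → ℝ → Em 4} (hT : 0 < T)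
    (hE : IsEternal ε₀ dyadicTable W) (hD : ∀ (n : ℤ) (σ : ℝ), W (n + 1) σ = W n (σ - T))
    {C : ℝ} (hC : ∀ (n : ℤ) (σ : ℝ), ‖W n σ‖ ≤ C) (hne : ∃ n σ, W n σ ≠ 0) :
    1 / (6 * bigLam ε₀ + 2 / bigLam ε₀)
      ≤ (C + bigLam ε₀ * C ^ 2 + C ^ 2 / bigLam ε₀) * (Real.exp T - 1) := by
  have hW := isDSSWave_of_shellSelfSimilar hT hE hD
  have hne' : ∃ x, (fun _ : Fin 1 => W 0) 0 x ≠ 0 := by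
    by_contra h
    push Not at h
    obtain ⟨n, σ, hnσ⟩ := hne
    exact hnσ (eq_zero_of_shell_zero hD (fun σ => h σ) n σ)
  exact delay_floor_of_dssWave hε hW hne' (fun x => hC 0 x)

/-- **Delay floor, `UniformBound` form**: for every non-zero uniformly bounded admissible inviscid
shell-self-similar eternal solution of the dyadic member there is an explicit `c > 0` (depending on the spread
and its uniform bound) with `e^T ≥ 1 + c`. [cite: Tao2016AveragedNS, §1.2, §4, §6.4; cell theorem] -/
theorem exp_delay_ge_of_uniformBound (hε : 0 < ε₀) {W : ℤ → ℝ → Em 4} (hT : 0 < T)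
    (hE : IsEternal ε₀ dyadicTable W) (hD : ∀ (n : ℤ) (σ : ℝ), W (n + 1) σ = W n (σ - T))
    (hU : UniformBound W) (hne : ∃ n σ, W n σ ≠ 0) :
    ∃ C : ℝ, 0 < C ∧ (∀ (n : ℤ) (σ : ℝ), ‖W n σ‖ ≤ C) ∧
      1 + 1 / ((6 * bigLam ε₀ + 2 / bigLam ε₀) * (C + bigLam ε₀ * C ^ 2 + C ^ 2 / bigLam ε₀))
        ≤ Real.exp T := by
  obtain ⟨C₀, hC₀⟩ := hU
  have hΛ : 0 < bigLam ε₀ := bigLam_pos (by linarith)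
  -- use `C = max C₀ 1 > 0`
  set C : ℝ := max C₀ 1 with hCdef
  have hCpos : 0 < C := lt_of_lt_of_le one_pos (le_max_right _ _)
  have hC : ∀ (n : ℤ) (σ : ℝ), ‖W n σ‖ ≤ C := fun n σ => (hC₀ n σ).trans (le_max_left _ _)
  have h := delay_floor_of_shellSelfSimilar hε hT hE hD hC hne
  have hK : 0 < C + bigLam ε₀ * C ^ 2 + C ^ 2 / bigLam ε₀ := by positivity
  have hden : 0 < 6 * bigLam ε₀ + 2 / bigLam ε₀ := by positivity
  refine ⟨C, hCpos, hC, ?_⟩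
  rw [div_le_iff₀ hden] at h
  have : 1 / ((6 * bigLam ε₀ + 2 / bigLam ε₀) * (C + bigLam ε₀ * C ^ 2 + C ^ 2 / bigLam ε₀))
      ≤ Real.exp T - 1 := by
    rw [div_le_iff₀ (mul_pos hden hK)]
    linarith [h]
  linarith

end WakeRatchetDSSDelayFloor

end Summit.NavierStokesRegularity.NavierStokesRegularity.Theorems

end
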